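import Summits.Ventures.HodgeRepro2.T5UnitarianTrick
import Summits.Ventures.HodgeRepro2.T5Multiplicity

/-!
# Unitarization: the Schur relations and the character criterion for every continuous representation

Blind cell `pub-hodge-repro2`, seat p1 (gen 12), Tier-5 kernel support for the representation-theoretic
sentences of `route/T5-SUPPORT-p1.md` §S4.7.

`T5UnitarianTrick.unitarianCore μ π hπ` is the averaged (invariant) inner product on `V` as an
`InnerProductSpace.Core`; the gen-11 honest-scope line recorded that it «is a different inner-product
structure» and is «not composed» with the Schur relations, which take `IsUnitary π` for the GIVEN inner
product.  This file composes them through a **type synonym**: `Unitarized μ π hπ := V` carries the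
averaged inner product as its `InnerProductSpace` instance, and `unitarizedRep μ π hπ` is the same
family of linear maps `π g` read on the synonym (continuous because `V` is finite-dimensional).  Then

* `isUnitary_unitarizedRep` — the synonym representation is unitary (Lemma 3.3.16 of Goodman–Wallach,
  `unitarianCore_map_map`);
* `character_unitarizedRep` — it has the same character as `π` (same linear maps, same trace);
* `isIrreducible_unitarizedRep_iff` — it is irreducible iff `π` is (same stable subspaces);

so every Schur-type statement proved for unitary representations transfers to EVERY continuous
finite-dimensional representation of a compact group:

* `integral_character_mul_conj_of_isIrreducible` — `∫ |χ_π|² dμ = 1` for irreducible `π`;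
* `isIrreducible_iff_integral_character_mul_conj_eq_one` — the character criterion for irreducibility;
* `integral_character_mul_conj_eq_zero_of_isEmpty_equiv` — characters of inequivalent irreducible
  representations are orthogonal.

Print: Goodman–Wallach GTM 255 §3.3.4 (the unitarian trick, pp. 169–170) + §7.3.4 p. 360 (the compact-group
Schur relations «for U», held copy text pages p0266–p0267 / p0458).  Honest scope (unchanged): compact
groups and finite-dimensional representations only; nothing about U(1,1), π₃⁺ or (N).
-/

namespace Summit.Ventures.HodgeRepro2.T5Unitarization

open MeasureTheory T5SchurOrthogonality T5UnitarianTrick T5SchurMathlib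

variable {G : Type*} [Group G] [TopologicalSpace G] [IsTopologicalGroup G]
  [MeasurableSpace G] [BorelSpace G] [CompactSpace G]
variable {V : Type*} [NormedAddCommGroup V] [InnerProductSpace ℂ V]
variable (μ : Measure G) [IsProbabilityMeasure μ] [μ.IsOpenPosMeasure]
variable (π : G →* V →L[ℂ] V) (hπ : Continuous π)

/-- The type synonym of `V` carrying the averaged (π-invariant) inner product of the unitarian trick
as its inner-product-space structure. -/
def Unitarized (_μ : Measure G) (_π : G →* V →L[ℂ] V) (_hπ : Continuous _π) : Type _ := V

/-- The additive group of the synonym is that of `V`. -/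
instance : AddCommGroup (Unitarized μ π hπ) := inferInstanceAs (AddCommGroup V)

/-- The `ℂ`-module structure of the synonym is that of `V`. -/
instance : Module ℂ (Unitarized μ π hπ) := inferInstanceAs (Module ℂ V)

/-- The averaged inner product as an `InnerProductSpace.Core` on the synonym. -/
@[reducible] noncomputable def unitarizedCore : InnerProductSpace.Core ℂ (Unitarized μ π hπ) :=
  unitarianCore (V := V) μ π hπ

/-- The norm of the synonym: `‖v‖' = √⟨v|v⟩'`. -/
noncomputable instance : NormedAddCommGroup (Unitarized μ π hπ) :=
  (unitarizedCore μ π hπ).toNormedAddCommGroup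

/-- The synonym is an inner product space for the averaged inner product. -/
noncomputable instance : InnerProductSpace ℂ (Unitarized μ π hπ) :=
  InnerProductSpace.ofCore (unitarizedCore μ π hπ).toCore

/-- The synonym is finite-dimensional when `V` is. -/
instance [FiniteDimensional ℂ V] : FiniteDimensional ℂ (Unitarized μ π hπ) :=
  inferInstanceAs (FiniteDimensional ℂ V)

/-- The synonym is non-trivial when `V` is. -/
instance [Nontrivial V] : Nontrivial (Unitarized μ π hπ) := inferInstanceAs (Nontrivial V)

/-- The inner product of the synonym is the averaged inner product. -/
theorem inner_unitarized (v w : Unitarized μ π hπ) :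
    inner ℂ v w = avgInner μ π (v : V) (w : V) := by
  change (unitarianCore (V := V) μ π hπ).inner v w = _
  exact unitarianCore_inner μ π hπ v w

variable [FiniteDimensional ℂ V]

/-- The linear map `π g` read on the synonym, as a continuous linear map (finite dimension). -/
noncomputable def unitarizedMap (g : G) : Unitarized μ π hπ →L[ℂ] Unitarized μ π hπ :=
  LinearMap.toContinuousLinearMap
    (show Unitarized μ π hπ →ₗ[ℂ] Unitarized μ π hπ from (π g : V →ₗ[ℂ] V))

/-- `unitarizedMap g` acts as `π g`. -/
@[simp]
theorem unitarizedMap_apply (g : G) (v : Unitarized μ π hπ) :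
    unitarizedMap μ π hπ g v = π g (v : V) := rfl

/-- The representation `π` read on the synonym. -/
noncomputable def unitarizedRep : G →* (Unitarized μ π hπ →L[ℂ] Unitarized μ π hπ) where
  toFun := unitarizedMap μ π hπ
  map_one' := by
    ext v
    simp only [unitarizedMap_apply, map_one, one_apply_eq_self]
  map_mul' g h := by
    ext v
    simp only [unitarizedMap_apply, map_mul, mul_apply_eq_comp]

/-- `unitarizedRep g` acts as `π g`. -/
@[simp]
theorem unitarizedRep_apply (g : G) (v : Unitarized μ π hπ) :
    unitarizedRep μ π hπ g v = π g (v : V) := rfl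

/-- The synonym representation is unitary for the averaged inner product (Lemma 3.3.16). -/
theorem isUnitary_unitarizedRep [μ.IsMulLeftInvariant] : IsUnitary (unitarizedRep μ π hπ) := by
  intro h v w
  rw [inner_unitarized, inner_unitarized, unitarizedRep_apply, unitarizedRep_apply]
  exact avgInner_map_map μ π h v w

/-- The synonym representation has the character of `π` (the same linear maps, the same trace). -/
theorem character_unitarizedRep (g : G) :
    character (unitarizedRep μ π hπ) g = character π g := rfl

/-- Stable subspaces of the synonym representation are the stable subspaces of `π`. -/
theorem isIrreducible_unitarizedRep_iff :
    IsIrreducible (unitarizedRep μ π hπ) ↔ IsIrreducible π :=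
  Iff.rfl

/-- The synonym representation is continuous: `g ↦ π g` composed with the linear (hence continuous,
finite dimension) map `(V →L[ℂ] V) → (U →L[ℂ] U)` reading a map on the synonym. -/
theorem continuous_unitarizedRep : Continuous (unitarizedRep μ π hπ) := by
  let Φ : (V →L[ℂ] V) →ₗ[ℂ] (Unitarized μ π hπ →L[ℂ] Unitarized μ π hπ) :=
    { toFun := fun f => LinearMap.toContinuousLinearMap
        (show Unitarized μ π hπ →ₗ[ℂ] Unitarized μ π hπ from (f : V →ₗ[ℂ] V))
      map_add' := fun f₁ f₂ => by ext v; rfl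
      map_smul' := fun c f => by ext v; rfl }
  have hΦ : Continuous Φ := LinearMap.continuous_of_finiteDimensional Φ
  exact hΦ.comp hπ

/-- `toRep` of the synonym representation is `toRep π` pointwise (the same linear maps). -/
theorem toRep_unitarizedRep_apply (g : G) (v : V) :
    toRep (unitarizedRep μ π hπ) g v = toRep π g v := rfl

section schur

variable [μ.IsMulLeftInvariant]

include hπ in
/-- **Schur's relation for the character of every continuous irreducible representation** of a compact
group: `∫ |χ_π|² dμ = 1` (no unitarity hypothesis — `T5SchurOrthogonality.integral_character_mul_conj`
applied to the unitarized synonym, which has the same character). -/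
theorem integral_character_mul_conj_of_isIrreducible [Nontrivial V] (hirr : IsIrreducible π) :
    ∫ g, character π g * (starRingEnd ℂ) (character π g) ∂μ = 1 :=
  integral_character_mul_conj (unitarizedRep μ π hπ) μ (continuous_unitarizedRep μ π hπ)
    (isUnitary_unitarizedRep μ π hπ) ((isIrreducible_unitarizedRep_iff μ π hπ).mpr hirr)

include hπ in
/-- **The character criterion for irreducibility, for every continuous representation**:
`π` is irreducible iff `∫ |χ_π|² dμ = 1` (no unitarity hypothesis —
`T5Multiplicity.isIrreducible_iff_integral_character_mul_conj_eq_one` on the unitarized synonym). -/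
theorem isIrreducible_iff_integral_character_mul_conj_eq_one [Nontrivial V] :
    IsIrreducible π ↔ ∫ g, character π g * (starRingEnd ℂ) (character π g) ∂μ = 1 :=
  (isIrreducible_unitarizedRep_iff μ π hπ).symm.trans
    (T5Multiplicity.isIrreducible_iff_integral_character_mul_conj_eq_one (unitarizedRep μ π hπ) μ
      (continuous_unitarizedRep μ π hπ) (isUnitary_unitarizedRep μ π hπ))

include hπ in
/-- **Characters of inequivalent irreducible representations are orthogonal**, for arbitrary continuous
`π`, `σ` (no unitarity): `T5SchurMathlib.integral_character_mul_conj_eq_zero` needs only `σ` unitary,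
so `σ` is replaced by its unitarized synonym, which has the same character and the same `toRep`. -/
theorem integral_character_mul_conj_eq_zero {W : Type*} [NormedAddCommGroup W]
    [InnerProductSpace ℂ W] [FiniteDimensional ℂ W] (σ : G →* W →L[ℂ] W) (hσ : Continuous σ)
    [(toRep π).IsIrreducible] [(toRep σ).IsIrreducible] [IsEmpty ((toRep σ).Equiv (toRep π))] :
    ∫ g, character π g * (starRingEnd ℂ) (character σ g) ∂μ = 0 := by
  haveI : (toRep (unitarizedRep μ σ hσ)).IsIrreducible := ‹(toRep σ).IsIrreducible›
  haveI : IsEmpty ((toRep (unitarizedRep μ σ hσ)).Equiv (toRep π)) :=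
    ‹IsEmpty ((toRep σ).Equiv (toRep π))›
  exact T5SchurMathlib.integral_character_mul_conj_eq_zero π (unitarizedRep μ σ hσ) μ hπ
    (continuous_unitarizedRep μ σ hσ) (isUnitary_unitarizedRep μ σ hσ)

end schur

section haar

variable [T2Space G]

/-- The normalised Haar measure of a compact Hausdorff group is positive on open sets
(`IsHaarMeasure`). -/
instance isOpenPosMeasure_haarProb : (haarProb G).IsOpenPosMeasure := by
  unfold haarProb; infer_instance

/-- `∫ |χ_π|² = 1` for every continuous irreducible finite-dimensional representation of a compact
Hausdorff group, against the normalised Haar measure — no measure in the statement. -/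
theorem integral_character_mul_conj_of_isIrreducible_haar [Nontrivial V] (hπ : Continuous π)
    (hirr : IsIrreducible π) :
    ∫ g, character π g * (starRingEnd ℂ) (character π g) ∂(haarProb G) = 1 :=
  integral_character_mul_conj_of_isIrreducible (haarProb G) π hπ hirr

/-- The character criterion for irreducibility against the normalised Haar measure. -/
theorem isIrreducible_iff_integral_character_mul_conj_eq_one_haar [Nontrivial V]
    (hπ : Continuous π) :
    IsIrreducible π ↔ ∫ g, character π g * (starRingEnd ℂ) (character π g) ∂(haarProb G) = 1 :=
  isIrreducible_iff_integral_character_mul_conj_eq_one (haarProb G) π hπ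

end haar

end Summit.Ventures.HodgeRepro2.T5Unitarization
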